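import Literature.NumberTheory.Rogawski1990.ArchCentralLimitFormula        -- ★ p842205 (o-L21): the (L_{U(2,1)}) letter `ArchCentralLimitFormulaRankTwo`
import Literature.NumberTheory.Automorphic.ArchCongruenceOrbitalTransport    -- ★ (T-d) FILE 1: `formCongr_quasiSplitFrame_diagonal`, the `quasiSplitWeights` guards
import Literature.NumberTheory.Automorphic.ArchLocalRegularOrbitClosed       -- ★ `locallyCompactSpace_archLocal`, `secondCountableTopology_archLocal`
import HarnessLib

/-!
# The (L_{U(2,1)}) letter AT THE QUASI-SPLIT FRAME `diag(½, 1, −½)` — node N3 of SdArch ED. 3 in form (n3-0) «pull the test function, not the letter»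

Topic `NumberTheory/Rogawski1990`; namespace `Literature.NumberTheory.Rogawski1990`.  THEOREMS ONLY (kernel lane, count-neutral, `--supports` H413); no `def`, no instance,
no `sorry`.  Cell `pub/hodgecm-mathlib`, ENGINE T1 (crux H413 = `stmt-HodgeConjecture-24833`); ROAD-Sd residual R4, SdArch ED. 3 DESIGN (F0P3a-p03 (g11) census
`CENSUS-SdArch-ED3-Design` 7141d221, LEAD WORD T8-135) node **N3 «central letter transport»** (handed to F0P3a-p02 (g11) by F0P3a-p06 (g11) 07:32:46Z); typed by
F0P3a-p02 (g11), 2026-09-01.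

WHAT N3 DELIVERS (form (n3-0), the 3Z way).  The `G`-side of (S-d) is the quasi-split group `G_∞ = U(Φ₃)(L ⊗ ℝ)`; by the RATIONAL congruence ★ `formCongr_quasiSplitFrame_diagonal`
(`Qᵀ·diag(½,1,−½)·Q = Φ₃`) its archimedean places are `archLocal L 3 (diagonal β) w`, `β = (½, 1, −½)`, and — exactly as ★ (E1) `ArchDeltaTransferHaarForm` ∕ ★ (β₀)
`ArchEndoscopicTorusTransferIdentityPre` did for (S-c) — the descent engine N5 reads the `G`-side orbital integrals with the TEST FUNCTION pulled back along the congruence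
(`a ∘ ψ.symm ∘ (archPiEquivCM 3 L (diagonal β)).symm`), on the diagonal carrier.  There the letter ★ `ArchCentralLimitFormulaRankTwo L β w` applies BY NAME at EVERY complex
place: this file discharges its three frame guards for `β` (★ `quasiSplitWeights_ne_zero`, ★ `im_embedding_quasiSplitWeights_eq_zero`, ★ `re_embedding_quasiSplitWeights_zero_mul_two_neg`
— every complex place of `diag β` is a `(2,1)` place) and its topological instance binders (★ `locallyCompactSpace_archLocal`, ★ `secondCountableTopology_archLocal`), and records
the generic CLAUSE EXTRACTOR (any diagonal `α`, guards as hypotheses — the `G′`-side at its indefinite places) and the `ν ↦ c • ν` remark (the clause for a rescaled Haar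
measure is an INSTANCE of the letter's `∀ ν`, nothing to transport — the (D2) choice `ν := κ′·(∏_w c′_w ∕ c_w) • …` of the design census).  No analysis: three `exact`s.
HONEST LABEL: HC_CM is proved only modulo the printed citations until rung 0 closes; every theorem here is CONDITIONAL on the letter hypothesis `h : ArchCentralLimitFormulaRankTwo L _ w`
(node N1 = the registered stub `stub_ArchCentralLimitU21` of ED. 3), which it consumes by name and does not prove.

## References
* [Rogawski1990] J. D. Rogawski, *Automorphic Representations of Unitary Groups in Three Variables* (1990), §8.4 pp. 126–127 (the central limit formula), §14.1 p. 232 (the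
  quasi-split form `Φ₃`), §14.5 p. 239 ((S-d)).
-/

open MeasureTheory Measure Filter Topology NumberField NumberField.InfinitePlace
open Literature.NumberTheory.Automorphic Literature.NumberTheory.Automorphic.UnitaryGroup
open scoped Matrix MatrixGroups Matrix.Norms.Operator ENNReal

namespace Literature.NumberTheory.Rogawski1990

section Clause

variable {L : Type} [Field L] {α : Fin 3 → L} {w : {w : InfinitePlace L // IsComplex w}}

/-- **CLAUSE EXTRACTOR** for the (L_{U(2,1)}) letter ★ `ArchCentralLimitFormulaRankTwo` at a diagonal carrier `diag α` whose place `w` is INDEFINITE: given the letter `h`, the frame guards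
`hα`, `hreal` and the indefinite-signature witness `hind`, every Haar right-invariant `ν` on `G_w = U(σ_w diag α)(ℂ) ≅ U(2,1)` has its constant `c > 0` with the 8-ray central limit
`Λ₈[ρ′Δ·Φ_Θ] → −(c·i)·Θ(ζ•1)` for all smooth compactly supported `Θ` (the topological instance binders of the `def` are discharged by ★ `locallyCompactSpace_archLocal`,
★ `secondCountableTopology_archLocal`).  Used on the `G′`-side of (S-d) at its indefinite places. [cite: Rogawski1990, §8.4 pp. 126–127] -/
theorem ArchCentralLimitFormulaRankTwo.clause
    [MeasurableSpace (archLocal L 3 (Matrix.diagonal α) w)] [BorelSpace (archLocal L 3 (Matrix.diagonal α) w)]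
    (h : ArchCentralLimitFormulaRankTwo L α w) (hα : ∀ i, α i ≠ 0) (hreal : ∀ i, (w.1.embedding (α i)).im = 0)
    (hind : ∃ i j : Fin 3, (w.1.embedding (α i)).re * (w.1.embedding (α j)).re < 0)
    (ν : Measure (archLocal L 3 (Matrix.diagonal α) w)) [ν.IsHaarMeasure] [ν.IsMulRightInvariant] :
    ∃ c : ℝ, 0 < c ∧
      ∀ (Θ : Matrix (Fin 3) (Fin 3) ℂ → ℂ), ContDiff ℝ (⊤ : ℕ∞) Θ →
        HasCompactSupport (fun k : archLocal L 3 (Matrix.diagonal α) w => Θ ((k : GL (Fin 3) ℂ) : Matrix (Fin 3) (Fin 3) ℂ)) →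
        ∀ ζ : Circle,
          Tendsto (fun z : Fin 3 → Circle =>
              (1 / 48 : ℂ) * ∑ ε : Fin 3 → Bool, ((((if ε 0 then (1 : ℝ) else -1) * (if ε 1 then (1 : ℝ) else -1) * (if ε 2 then (1 : ℝ) else -1) : ℝ)) : ℂ) *
                iteratedDeriv 3 (fun s : ℝ => ((((z 0 * Circle.exp (s * (![(if ε 0 then (1 : ℝ) else -1) + (if ε 1 then (1 : ℝ) else -1), -(if ε 0 then (1 : ℝ) else -1) + (if ε 2 then (1 : ℝ) else -1), -(if ε 1 then (1 : ℝ) else -1) - (if ε 2 then (1 : ℝ) else -1)] 0)) : Circle) : ℂ)) * (((z 2 * Circle.exp (s * (![(if ε 0 then (1 : ℝ) else -1) + (if ε 1 then (1 : ℝ) else -1), -(if ε 0 then (1 : ℝ) else -1) + (if ε 2 then (1 : ℝ) else -1), -(if ε 1 then (1 : ℝ) else -1) - (if ε 2 then (1 : ℝ) else -1)] 2)) : Circle) : ℂ))⁻¹) * ((1 - (((z 1 * Circle.exp (s * (![(if ε 0 then (1 : ℝ) else -1) + (if ε 1 then (1 : ℝ) else -1), -(if ε 0 then (1 : ℝ)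 else -1) + (if ε 2 then (1 : ℝ) else -1), -(if ε 1 then (1 : ℝ) else -1) - (if ε 2 then (1 : ℝ) else -1)] 1)) : Circle) : ℂ)) * (((z 0 * Circle.exp (s * (![(if ε 0 then (1 : ℝ) else -1) + (if ε 1 then (1 : ℝ) else -1), -(if ε 0 then (1 : ℝ) else -1) + (if ε 2 then (1 : ℝ) else -1), -(if ε 1 then (1 : ℝ) else -1) - (if ε 2 then (1 : ℝ) else -1)] 0)) : Circle) : ℂ))⁻¹) * (1 - (((z 2 * Circle.exp (s * (![(if ε 0 then (1 : ℝ) else -1) + (if ε 1 then (1 : ℝ) else -1), -(if ε 0 then (1 : ℝ) else -1) + (if ε 2 then (1 : ℝ) else -1), -(if ε 1 then (1 : ℝ) else -1) - (if ε 2 then (1 : ℝ) else -1)] 2)) : Circle) : ℂ)) * (((z 1 * Circle.exp (s * (![(if ε 0 then (1 : ℝ) else -1) + (if ε 1 then (1 : ℝ) else -1), -(if ε 0 then (1 : ℝ) else -1) + (if ε 2 then (1 : ℝ) else -1), -(if ε 1 then (1 : ℝ) else -1) - (if ε 2 then (1 : ℝ) else -1)] 1)) : Circle) : ℂ))⁻¹)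 * (1 - (((z 2 * Circle.exp (s * (![(if ε 0 then (1 : ℝ) else -1) + (if ε 1 then (1 : ℝ) else -1), -(if ε 0 then (1 : ℝ) else -1) + (if ε 2 then (1 : ℝ) else -1), -(if ε 1 then (1 : ℝ) else -1) - (if ε 2 then (1 : ℝ) else -1)] 2)) : Circle) : ℂ)) * (((z 0 * Circle.exp (s * (![(if ε 0 then (1 : ℝ) else -1) + (if ε 1 then (1 : ℝ) else -1), -(if ε 0 then (1 : ℝ) else -1) + (if ε 2 then (1 : ℝ) else -1), -(if ε 1 then (1 : ℝ) else -1) - (if ε 2 then (1 : ℝ) else -1)] 0)) : Circle) : ℂ))⁻¹)) * (∫ g, Θ (((g * ⟨circleDiagonal 3 (fun k => z k * Circle.exp (s * (![(if ε 0 then (1 : ℝ) else -1) + (if ε 1 then (1 : ℝ) else -1), -(if ε 0 then (1 : ℝ) else -1) + (if ε 2 then (1 : ℝ) else -1), -(if ε 1 then (1 : ℝ) else -1) - (if ε 2 then (1 : ℝ) else -1)] k))), circleDiagonal_mem_archLocal_diagonal L 3 α w _⟩ * g⁻¹ : archLocal L 3 (Matrix.diagonal α) w) : GL (Fin 3) ℂ)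 : Matrix (Fin 3) (Fin 3) ℂ) ∂ν)) 0)
            (𝓝[{z : Fin 3 → Circle | Function.Injective z}] (fun _ => ζ))
            (𝓝 (-((c : ℂ) * Complex.I) * Θ ((circleDiagonal 3 (fun _ => ζ) : GL (Fin 3) ℂ) : Matrix (Fin 3) (Fin 3) ℂ))) :=
  haveI := locallyCompactSpace_archLocal L 3 (Matrix.diagonal α) w
  haveI := secondCountableTopology_archLocal L 3 (Matrix.diagonal α) w
  h hα hreal hind ν

/-- **THE `ν ↦ c • ν` REMARK** (design census (D2): `ν := κ′·(∏_w c′_w ∕ c_w) • …` is a POSITIVE REAL rescaling of a Haar measure): the letter's clause for `κ • ν`, `κ ∈ (0, ∞)`, is an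
INSTANCE of its `∀ ν` (`κ • ν` is again Haar and right-invariant) — nothing to transport; recorded so the N6 assembler cites one name. [cite: Rogawski1990, §8.4 pp. 126–127] -/
theorem ArchCentralLimitFormulaRankTwo.clause_smul
    [MeasurableSpace (archLocal L 3 (Matrix.diagonal α) w)] [BorelSpace (archLocal L 3 (Matrix.diagonal α) w)]
    (h : ArchCentralLimitFormulaRankTwo L α w) (hα : ∀ i, α i ≠ 0) (hreal : ∀ i, (w.1.embedding (α i)).im = 0)
    (hind : ∃ i j : Fin 3, (w.1.embedding (α i)).re * (w.1.embedding (α j)).re < 0)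
    (ν : Measure (archLocal L 3 (Matrix.diagonal α) w)) [ν.IsHaarMeasure] [ν.IsMulRightInvariant]
    {κ : ℝ≥0∞} (hκ0 : κ ≠ 0) (hκtop : κ ≠ ∞) :
    ∃ c : ℝ, 0 < c ∧
      ∀ (Θ : Matrix (Fin 3) (Fin 3) ℂ → ℂ), ContDiff ℝ (⊤ : ℕ∞) Θ →
        HasCompactSupport (fun k : archLocal L 3 (Matrix.diagonal α) w => Θ ((k : GL (Fin 3) ℂ) : Matrix (Fin 3) (Fin 3) ℂ)) →
        ∀ ζ : Circle,
          Tendsto (fun z : Fin 3 → Circle =>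
              (1 / 48 : ℂ) * ∑ ε : Fin 3 → Bool, ((((if ε 0 then (1 : ℝ) else -1) * (if ε 1 then (1 : ℝ) else -1) * (if ε 2 then (1 : ℝ) else -1) : ℝ)) : ℂ) *
                iteratedDeriv 3 (fun s : ℝ => ((((z 0 * Circle.exp (s * (![(if ε 0 then (1 : ℝ) else -1) + (if ε 1 then (1 : ℝ) else -1), -(if ε 0 then (1 : ℝ) else -1) + (if ε 2 then (1 : ℝ) else -1), -(if ε 1 then (1 : ℝ) else -1) - (if ε 2 then (1 : ℝ) else -1)] 0)) : Circle) : ℂ)) * (((z 2 * Circle.exp (s * (![(if ε 0 then (1 : ℝ) else -1) + (if ε 1 then (1 : ℝ) else -1), -(if ε 0 then (1 : ℝ) else -1) + (if ε 2 then (1 : ℝ) else -1), -(if ε 1 then (1 : ℝ) else -1) - (if ε 2 then (1 : ℝ) else -1)] 2)) : Circle) : ℂ))⁻¹) * ((1 - (((z 1 * Circle.exp (s * (![(if ε 0 then (1 : ℝ) else -1) + (if ε 1 then (1 : ℝ) else -1), -(if ε 0 then (1 : ℝ) else -1) + (if ε 2 then (1 : ℝ) else -1), -(if ε 1 then (1 :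 ℝ) else -1) - (if ε 2 then (1 : ℝ) else -1)] 1)) : Circle) : ℂ)) * (((z 0 * Circle.exp (s * (![(if ε 0 then (1 : ℝ) else -1) + (if ε 1 then (1 : ℝ) else -1), -(if ε 0 then (1 : ℝ) else -1) + (if ε 2 then (1 : ℝ) else -1), -(if ε 1 then (1 : ℝ) else -1) - (if ε 2 then (1 : ℝ) else -1)] 0)) : Circle) : ℂ))⁻¹) * (1 - (((z 2 * Circle.exp (s * (![(if ε 0 then (1 : ℝ) else -1) + (if ε 1 then (1 : ℝ) else -1), -(if ε 0 then (1 : ℝ) else -1) + (if ε 2 then (1 : ℝ) else -1), -(if ε 1 then (1 : ℝ) else -1) - (if ε 2 then (1 : ℝ) else -1)] 2)) : Circle) : ℂ)) * (((z 1 * Circle.exp (s * (![(if ε 0 then (1 : ℝ) else -1) + (if ε 1 then (1 : ℝ) else -1), -(if ε 0 then (1 : ℝ) else -1) + (if ε 2 then (1 : ℝ) else -1), -(if ε 1 then (1 : ℝ) else -1) - (if ε 2 then (1 : ℝ) else -1)] 1)) : Circle) : ℂ))⁻¹) * (1 - (((z 2 * Circle.exp (s * (![(if ε 0 then (1 : ℝ)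 else -1) + (if ε 1 then (1 : ℝ) else -1), -(if ε 0 then (1 : ℝ) else -1) + (if ε 2 then (1 : ℝ) else -1), -(if ε 1 then (1 : ℝ) else -1) - (if ε 2 then (1 : ℝ) else -1)] 2)) : Circle) : ℂ)) * (((z 0 * Circle.exp (s * (![(if ε 0 then (1 : ℝ) else -1) + (if ε 1 then (1 : ℝ) else -1), -(if ε 0 then (1 : ℝ) else -1) + (if ε 2 then (1 : ℝ) else -1), -(if ε 1 then (1 : ℝ) else -1) - (if ε 2 then (1 : ℝ) else -1)] 0)) : Circle) : ℂ))⁻¹)) * (∫ g, Θ (((g * ⟨circleDiagonal 3 (fun k => z k * Circle.exp (s * (![(if ε 0 then (1 : ℝ) else -1) + (if ε 1 then (1 : ℝ) else -1), -(if ε 0 then (1 : ℝ) else -1) + (if ε 2 then (1 : ℝ) else -1), -(if ε 1 then (1 : ℝ) else -1) - (if ε 2 then (1 : ℝ) else -1)] k))), circleDiagonal_mem_archLocal_diagonal L 3 α w _⟩ * g⁻¹ : archLocal L 3 (Matrix.diagonal α) w) : GL (Fin 3) ℂ) : Matrix (Fin 3) (Fin 3) ℂ) ∂(κ • ν))) 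0)
            (𝓝[{z : Fin 3 → Circle | Function.Injective z}] (fun _ => ζ))
            (𝓝 (-((c : ℂ) * Complex.I) * Θ ((circleDiagonal 3 (fun _ => ζ) : GL (Fin 3) ℂ) : Matrix (Fin 3) (Fin 3) ℂ))) :=
  haveI := IsHaarMeasure.smul ν hκ0 hκtop
  h.clause hα hreal hind (κ • ν)

/-- **N3 (n3-0): THE LETTER AT THE QUASI-SPLIT FRAME, GUARDS DISCHARGED.**  For `β = (½, 1, −½)` (★ `formCongr_quasiSplitFrame_diagonal`: `U(Φ₃)(L ⊗ ℝ) ≅ U(diag β)(L ⊗ ℝ)` rationally)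
EVERY complex place `w` is a `(2,1)` place (★ `re_embedding_quasiSplitWeights_zero_mul_two_neg`: `re σ_wβ₀ · re σ_wβ₂ = −¼ < 0`), `β_i ≠ 0` (★ `quasiSplitWeights_ne_zero`) and `σ_wβ_i` is real
(★ `im_embedding_quasiSplitWeights_eq_zero`); so the letter `h : ArchCentralLimitFormulaRankTwo L β w` yields its clause for every Haar right-invariant `ν` on `U(σ_w diag β)(ℂ)` with no
side condition — the form in which the `G`-side of the (S-d) descent (N5, test functions pulled back along the congruence as in ★ (E1)∕(β₀)) consumes node N1 at every place.
[cite: Rogawski1990, §8.4 pp. 126–127; §14.1 p. 232] -/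
theorem archCentralLimitFormula_clause_of_quasiSplitWeights
    [MeasurableSpace (archLocal L 3 (Matrix.diagonal ![(2 : L)⁻¹, 1, -(2 : L)⁻¹]) w)] [BorelSpace (archLocal L 3 (Matrix.diagonal ![(2 : L)⁻¹, 1, -(2 : L)⁻¹]) w)]
    [NumberField L] (h : ArchCentralLimitFormulaRankTwo L ![(2 : L)⁻¹, 1, -(2 : L)⁻¹] w)
    (ν : Measure (archLocal L 3 (Matrix.diagonal ![(2 : L)⁻¹, 1, -(2 : L)⁻¹]) w)) [ν.IsHaarMeasure] [ν.IsMulRightInvariant] :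
    ∃ c : ℝ, 0 < c ∧
      ∀ (Θ : Matrix (Fin 3) (Fin 3) ℂ → ℂ), ContDiff ℝ (⊤ : ℕ∞) Θ →
        HasCompactSupport (fun k : archLocal L 3 (Matrix.diagonal ![(2 : L)⁻¹, 1, -(2 : L)⁻¹]) w => Θ ((k : GL (Fin 3) ℂ) : Matrix (Fin 3) (Fin 3) ℂ)) →
        ∀ ζ : Circle,
          Tendsto (fun z : Fin 3 → Circle =>
              (1 / 48 : ℂ) * ∑ ε : Fin 3 → Bool, ((((if ε 0 then (1 : ℝ) else -1) * (if ε 1 then (1 : ℝ) else -1) * (if ε 2 then (1 : ℝ) else -1) : ℝ)) : ℂ) *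
                iteratedDeriv 3 (fun s : ℝ => ((((z 0 * Circle.exp (s * (![(if ε 0 then (1 : ℝ) else -1) + (if ε 1 then (1 : ℝ) else -1), -(if ε 0 then (1 : ℝ) else -1) + (if ε 2 then (1 : ℝ) else -1), -(if ε 1 then (1 : ℝ) else -1) - (if ε 2 then (1 : ℝ) else -1)] 0)) : Circle) : ℂ)) * (((z 2 * Circle.exp (s * (![(if ε 0 then (1 : ℝ) else -1) + (if ε 1 then (1 : ℝ) else -1), -(if ε 0 then (1 : ℝ) else -1) + (if ε 2 then (1 : ℝ) else -1), -(if ε 1 then (1 : ℝ) else -1) - (if ε 2 then (1 : ℝ) else -1)] 2)) : Circle) : ℂ))⁻¹) * ((1 - (((z 1 * Circle.exp (s * (![(if ε 0 then (1 : ℝ) else -1) + (if ε 1 then (1 : ℝ) else -1), -(if ε 0 then (1 : ℝ) else -1) + (if ε 2 then (1 : ℝ) else -1), -(if ε 1 then (1 : ℝ) else -1) - (if ε 2 then (1 : ℝ) else -1)] 1)) : Circle) : ℂ)) * (((z 0 * Circle.exp (s * (![(if ε 0 then (1 : ℝ) else -1) + (if ε 1 then (1 : ℝ) else -1), -(if ε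 0 then (1 : ℝ) else -1) + (if ε 2 then (1 : ℝ) else -1), -(if ε 1 then (1 : ℝ) else -1) - (if ε 2 then (1 : ℝ) else -1)] 0)) : Circle) : ℂ))⁻¹) * (1 - (((z 2 * Circle.exp (s * (![(if ε 0 then (1 : ℝ) else -1) + (if ε 1 then (1 : ℝ) else -1), -(if ε 0 then (1 : ℝ) else -1) + (if ε 2 then (1 : ℝ) else -1), -(if ε 1 then (1 : ℝ) else -1) - (if ε 2 then (1 : ℝ) else -1)] 2)) : Circle) : ℂ)) * (((z 1 * Circle.exp (s * (![(if ε 0 then (1 : ℝ) else -1) + (if ε 1 then (1 : ℝ) else -1), -(if ε 0 then (1 : ℝ) else -1) + (if ε 2 then (1 : ℝ) else -1), -(if ε 1 then (1 : ℝ) else -1) - (if ε 2 then (1 : ℝ) else -1)] 1)) : Circle) : ℂ))⁻¹) * (1 - (((z 2 * Circle.exp (s * (![(if ε 0 then (1 : ℝ) else -1) + (if ε 1 then (1 : ℝ) else -1), -(if ε 0 then (1 : ℝ) else -1) + (if ε 2 then (1 : ℝ) else -1), -(if ε 1 then (1 : ℝ) else -1) - (if ε 2 then (1 : ℝ) else -1)]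 2)) : Circle) : ℂ)) * (((z 0 * Circle.exp (s * (![(if ε 0 then (1 : ℝ) else -1) + (if ε 1 then (1 : ℝ) else -1), -(if ε 0 then (1 : ℝ) else -1) + (if ε 2 then (1 : ℝ) else -1), -(if ε 1 then (1 : ℝ) else -1) - (if ε 2 then (1 : ℝ) else -1)] 0)) : Circle) : ℂ))⁻¹)) * (∫ g, Θ (((g * ⟨circleDiagonal 3 (fun k => z k * Circle.exp (s * (![(if ε 0 then (1 : ℝ) else -1) + (if ε 1 then (1 : ℝ) else -1), -(if ε 0 then (1 : ℝ) else -1) + (if ε 2 then (1 : ℝ) else -1), -(if ε 1 then (1 : ℝ) else -1) - (if ε 2 then (1 : ℝ) else -1)] k))), circleDiagonal_mem_archLocal_diagonal L 3 ![(2 : L)⁻¹, 1, -(2 : L)⁻¹] w _⟩ * g⁻¹ : archLocal L 3 (Matrix.diagonal ![(2 : L)⁻¹, 1, -(2 : L)⁻¹]) w) : GL (Fin 3) ℂ) : Matrix (Fin 3) (Fin 3) ℂ) ∂ν)) 0)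
            (𝓝[{z : Fin 3 → Circle | Function.Injective z}] (fun _ => ζ))
            (𝓝 (-((c : ℂ) * Complex.I) * Θ ((circleDiagonal 3 (fun _ => ζ) : GL (Fin 3) ℂ) : Matrix (Fin 3) (Fin 3) ℂ))) :=
  h.clause (quasiSplitWeights_ne_zero L) (im_embedding_quasiSplitWeights_eq_zero L w) ⟨0, 2, re_embedding_quasiSplitWeights_zero_mul_two_neg L w⟩ ν

end Clause

end Literature.NumberTheory.Rogawski1990
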